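import Mathlib
import HarnessLib
import Summits.Ventures.LatticeQCDFlow.Scaling.TopologicalCollar

/-!
# `U(1)` rung: plaquettes, the LO flow field `Z` and the booked factor `C` ALONG THE HMC DRIFT — closed forms and Fréchet derivatives

HONEST FRAMING: exact (Metropolis-corrected) sampling algorithms for lattice gauge theory;
figures of merit are autocorrelation/cost numbers at stated couplings and volumes; no
continuum-physics claim.

Venture `LatticeQCDFlow` (cell pub-lqcd), topic `Exactness`; FANOUT row 14 (`eng-flowhmc`, engine
`latflow.fthmc`, family B, `U(1)` rung: links `GaugeConfig d L Circle`, momenta `Edge d L → ℝ`,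
drift `V_e ← e^(icp_e)·V_e`, the member's field `Z` and booked factor `C` VERBATIM as in
`exists_layers_u1WilsonFlowLO`).  NEW WORK of the cell over Mathlib and the tree's torus gauge
vocabulary (`plaquetteHolonomy`); nothing is cited as a fact; no number.  First file of the GEN-13
chain that computes the engine's EXACT (autodiff) force THROUGH the LO member in closed form with
volume-independent bounds (`U1SubstepForceChainRule`, `U1SubstepForceBounds`, …).

* §1 `plaquetteHolonomy_circleDrift` — along the drift every plaquette turns rigidly:
  `P(e^(icp)·V; x,i,j) = e^(ic(p(x,i) + p(x+î,j) − p(x+ĵ,i) − p(x,j))) · P(V; x,i,j)` (`U(1)` is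
  abelian); `circleDrift_zero` (`p = 0` is the identity).
* §2 `hasFDerivAt_im_plaquetteHolonomy_circleDrift` / `hasFDerivAt_re_plaquetteHolonomy_circleDrift`
  — at `p = 0`, `p ↦ Im P(e^(icp)·V)` has Fréchet derivative `(c · Re P(V)) • ℓ_P` and
  `p ↦ Re P(e^(icp)·V)` has `(−c · Im P(V)) • ℓ_P`, `ℓ_P = proj(x,i) + proj(x+î,j) − proj(x+ĵ,i) − proj(x,j)`
  the plaquette's incidence functional;
* §3 `hasFDerivAt_u1FlowField_circleDrift`, `hasFDerivAt_u1Factor_circleDrift` — hence the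
  derivatives at `p = 0` of `p ↦ Z_e(e^(icp)·V)` and `p ↦ C_e(e^(icp)·V)` as explicit continuous
  linear functionals (sums of `± Re / Im` of the `2(d−1)` plaquettes through `e` times their
  incidence functionals);
* §4 `abs_incidence_single_le` — `|ℓ_(x,i,j)(δ_e')| ≤ [e'=(x,i)] + [e'=(x+î,j)] + [e'=(x+ĵ,i)] + [e'=(x,j)]`,
  and the two translation counts `sum_ite_edge_translate_fst/snd` (`= d − 1`) from which the
  volume-independent incidence bound `Σ_e Σ_ν (|ℓ_(P⁻)(δ_e')| + |ℓ_(P⁺)(δ_e')|) ≤ 8(d−1)` of the next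
  files follows (`sum_abs_incidence_single_le`).

NOT CLAIMED: anything at `p ≠ 0` (not needed: forces are derivatives at `p = 0`); `SU(2)`; any number.
-/

noncomputable section

namespace Summit.Ventures.LatticeQCDFlow.Exactness

open Literature.MathematicalPhysics.QuantumFieldTheory
open scoped BigOperators

variable {d L : ℕ}

/-! ## §1 Plaquettes turn rigidly along the drift -/

section Algebra

/-- **`P(e^(icp)·V; x,i,j) = e^(ic(p(x,i) + p(x+î,j) − p(x+ĵ,i) − p(x,j))) · P(V; x,i,j)`.** -/
theorem plaquetteHolonomy_circleDrift (c : ℝ) (p : Edge d L → ℝ) (V : GaugeConfig d L Circle)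
    (x : Site d L) (i j : Fin d) :
    plaquetteHolonomy ((fun e : Edge d L => Circle.exp (c * p e)) * V) x i j =
      Circle.exp (c * (p (x, i) + p (x.shift i, j) - p (x.shift j, i) - p (x, j))) *
        plaquetteHolonomy V x i j := by
  have h : c * (p (x, i) + p (x.shift i, j) - p (x.shift j, i) - p (x, j)) =
      c * p (x, i) + c * p (x.shift i, j) - c * p (x.shift j, i) - c * p (x, j) := by ring
  rw [h, Circle.exp_sub, Circle.exp_sub, Circle.exp_add]
  apply Circle.ext
  simp only [plaquetteHolonomy, Pi.mul_apply, Circle.coe_mul, Circle.coe_inv, Circle.coe_div]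
  have h1 : ((Circle.exp (c * p (x.shift j, i)) : Circle) : ℂ) ≠ 0 := Circle.coe_ne_zero _
  have h2 : ((Circle.exp (c * p (x, j)) : Circle) : ℂ) ≠ 0 := Circle.coe_ne_zero _
  have h3 : ((V (x.shift j, i) : Circle) : ℂ) ≠ 0 := Circle.coe_ne_zero _
  have h4 : ((V (x, j) : Circle) : ℂ) ≠ 0 := Circle.coe_ne_zero _
  field_simp

/-- The same, as complex numbers: `P(e^(icp)·V) = exp(i·c·ℓ_P(p)) · P(V)`. -/
theorem coe_plaquetteHolonomy_circleDrift (c : ℝ) (p : Edge d L → ℝ) (V : GaugeConfig d L Circle)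
    (x : Site d L) (i j : Fin d) :
    ((plaquetteHolonomy ((fun e : Edge d L => Circle.exp (c * p e)) * V) x i j : Circle) : ℂ) =
      Complex.exp (((c * (p (x, i) + p (x.shift i, j) - p (x.shift j, i) - p (x, j)) : ℝ) : ℂ) *
          Complex.I) * ((plaquetteHolonomy V x i j : Circle) : ℂ) := by
  rw [plaquetteHolonomy_circleDrift, Circle.coe_mul, Circle.coe_exp]

/-- At `p = 0` the drift is the identity. -/
theorem circleDrift_zero (c : ℝ) (V : GaugeConfig d L Circle) :
    (fun e : Edge d L => Circle.exp (c * (0 : Edge d L → ℝ) e)) * V = V := by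
  funext e
  simp only [Pi.mul_apply, Pi.zero_apply, mul_zero, Circle.exp_zero, one_mul]

end Algebra

/-! ## §2 Fréchet derivatives of `Im P`, `Re P` along the drift at `p = 0` -/

section Deriv

variable [NeZero L]

omit [NeZero L] in
/-- The incidence functional of the plaquette `(x, i, j)` evaluated: `ℓ_P(v) = v(x,i) + v(x+î,j) − v(x+ĵ,i) − v(x,j)`. -/
theorem incidence_apply (x : Site d L) (i j : Fin d) (v : Edge d L → ℝ) :
    ((ContinuousLinearMap.proj (R := ℝ) (φ := fun _ : Edge d L => ℝ) (x, i) +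
        ContinuousLinearMap.proj (R := ℝ) (φ := fun _ : Edge d L => ℝ) (x.shift i, j) -
        ContinuousLinearMap.proj (R := ℝ) (φ := fun _ : Edge d L => ℝ) (x.shift j, i) -
        ContinuousLinearMap.proj (R := ℝ) (φ := fun _ : Edge d L => ℝ) (x, j)) v) =
      v (x, i) + v (x.shift i, j) - v (x.shift j, i) - v (x, j) := by
  simp only [add_apply, sub_apply, ContinuousLinearMap.proj_apply]

/-- The drifted plaquette as a complex number is Fréchet differentiable at `p = 0` with derivative
`v ↦ i·c·ℓ_P(v)·P(V)`. -/
theorem hasFDerivAt_coe_plaquetteHolonomy_circleDrift (c : ℝ) (V : GaugeConfig d L Circle)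
    (x : Site d L) (i j : Fin d) :
    HasFDerivAt (fun p : Edge d L → ℝ =>
        ((plaquetteHolonomy ((fun e : Edge d L => Circle.exp (c * p e)) * V) x i j : Circle) : ℂ))
      ((((plaquetteHolonomy V x i j : Circle) : ℂ) * (c * Complex.I)) •
        (Complex.ofRealCLM.comp
          (ContinuousLinearMap.proj (R := ℝ) (φ := fun _ : Edge d L => ℝ) (x, i) +
            ContinuousLinearMap.proj (R := ℝ) (φ := fun _ : Edge d L => ℝ) (x.shift i, j) -
            ContinuousLinearMap.proj (R := ℝ) (φ := fun _ : Edge d L => ℝ) (x.shift j, i) -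
            ContinuousLinearMap.proj (R := ℝ) (φ := fun _ : Edge d L => ℝ) (x, j)))) 0 := by
  set ℓ : (Edge d L → ℝ) →L[ℝ] ℝ :=
    ContinuousLinearMap.proj (R := ℝ) (φ := fun _ : Edge d L => ℝ) (x, i) +
      ContinuousLinearMap.proj (R := ℝ) (φ := fun _ : Edge d L => ℝ) (x.shift i, j) -
      ContinuousLinearMap.proj (R := ℝ) (φ := fun _ : Edge d L => ℝ) (x.shift j, i) -
      ContinuousLinearMap.proj (R := ℝ) (φ := fun _ : Edge d L => ℝ) (x, j) with hℓ_def
  -- the function, rewritten through §1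
  have hfun : (fun p : Edge d L → ℝ =>
        ((plaquetteHolonomy ((fun e : Edge d L => Circle.exp (c * p e)) * V) x i j : Circle) : ℂ)) =
      fun p : Edge d L → ℝ => Complex.exp ((((c • ℓ) p : ℝ) : ℂ) * Complex.I) *
        ((plaquetteHolonomy V x i j : Circle) : ℂ) := by
    funext p
    rw [coe_plaquetteHolonomy_circleDrift, smul_apply, smul_eq_mul, hℓ_def,
      incidence_apply]
  rw [hfun]
  have h1 : HasFDerivAt (fun p : Edge d L → ℝ => (((c • ℓ) p : ℝ) : ℂ))
      (Complex.ofRealCLM.comp (c • ℓ)) 0 :=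
    Complex.ofRealCLM.hasFDerivAt.comp (0 : Edge d L → ℝ) (c • ℓ).hasFDerivAt
  have h2 := ((h1.mul_const Complex.I).cexp).mul_const ((plaquetteHolonomy V x i j : Circle) : ℂ)
  have h0 : Complex.exp ((((c • ℓ) (0 : Edge d L → ℝ) : ℝ) : ℂ) * Complex.I) = 1 := by
    rw [map_zero, Complex.ofReal_zero, zero_mul, Complex.exp_zero]
  rw [h0, one_smul] at h2
  refine h2.congr_fderiv ?_
  ext v
  simp only [smul_apply, ContinuousLinearMap.comp_apply, Complex.ofRealCLM_apply, smul_eq_mul,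
    Complex.ofReal_mul]
  ring_nf

/-- **`p ↦ Im P(e^(icp)·V)` at `p = 0` has derivative `(c · Re P(V)) • ℓ_P`.** -/
theorem hasFDerivAt_im_plaquetteHolonomy_circleDrift (c : ℝ) (V : GaugeConfig d L Circle)
    (x : Site d L) (i j : Fin d) :
    HasFDerivAt (fun p : Edge d L → ℝ =>
        ((plaquetteHolonomy ((fun e : Edge d L => Circle.exp (c * p e)) * V) x i j : Circle) : ℂ).im)
      ((c * ((plaquetteHolonomy V x i j : Circle) : ℂ).re) •
        (ContinuousLinearMap.proj (R := ℝ) (φ := fun _ : Edge d L => ℝ) (x, i) +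
          ContinuousLinearMap.proj (R := ℝ) (φ := fun _ : Edge d L => ℝ) (x.shift i, j) -
          ContinuousLinearMap.proj (R := ℝ) (φ := fun _ : Edge d L => ℝ) (x.shift j, i) -
          ContinuousLinearMap.proj (R := ℝ) (φ := fun _ : Edge d L => ℝ) (x, j))) 0 := by
  have h := Complex.imCLM.hasFDerivAt.comp (0 : Edge d L → ℝ)
    (hasFDerivAt_coe_plaquetteHolonomy_circleDrift c V x i j)
  refine h.congr_fderiv ?_
  ext v
  simp only [ContinuousLinearMap.comp_apply, smul_apply, Complex.imCLM_apply,
    Complex.ofRealCLM_apply, smul_eq_mul, Complex.mul_im, Complex.mul_re, Complex.I_re, Complex.I_im,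
    Complex.ofReal_re, Complex.ofReal_im, incidence_apply]
  ring

/-- **`p ↦ Re P(e^(icp)·V)` at `p = 0` has derivative `(−c · Im P(V)) • ℓ_P`.** -/
theorem hasFDerivAt_re_plaquetteHolonomy_circleDrift (c : ℝ) (V : GaugeConfig d L Circle)
    (x : Site d L) (i j : Fin d) :
    HasFDerivAt (fun p : Edge d L → ℝ =>
        ((plaquetteHolonomy ((fun e : Edge d L => Circle.exp (c * p e)) * V) x i j : Circle) : ℂ).re)
      ((-(c * ((plaquetteHolonomy V x i j : Circle) : ℂ).im)) •
        (ContinuousLinearMap.proj (R := ℝ) (φ := fun _ : Edge d L => ℝ) (x, i) +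
          ContinuousLinearMap.proj (R := ℝ) (φ := fun _ : Edge d L => ℝ) (x.shift i, j) -
          ContinuousLinearMap.proj (R := ℝ) (φ := fun _ : Edge d L => ℝ) (x.shift j, i) -
          ContinuousLinearMap.proj (R := ℝ) (φ := fun _ : Edge d L => ℝ) (x, j))) 0 := by
  have h := Complex.reCLM.hasFDerivAt.comp (0 : Edge d L → ℝ)
    (hasFDerivAt_coe_plaquetteHolonomy_circleDrift c V x i j)
  refine h.congr_fderiv ?_
  ext v
  simp only [ContinuousLinearMap.comp_apply, smul_apply, Complex.reCLM_apply,
    Complex.ofRealCLM_apply, smul_eq_mul, Complex.mul_im, Complex.mul_re, Complex.I_re, Complex.I_im,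
    Complex.ofReal_re, Complex.ofReal_im, incidence_apply]
  ring

end Deriv

/-! ## §3 The LO flow field `Z_e` and the booked factor `C_e` along the drift -/

section Field

variable [NeZero L]

/-- **The derivative at `p = 0` of `p ↦ Z_e(e^(icp)·V)`**, `Z_e = Σ_(ν ≠ μ) [Im P(x−ν̂;μ,ν) − Im P(x;μ,ν)]`,
`e = (x, μ)`: the functional `Σ_ν [(c Re P(V; x−ν̂,μ,ν)) • ℓ_(x−ν̂,μ,ν) − (c Re P(V; x,μ,ν)) • ℓ_(x,μ,ν)]`. -/
theorem hasFDerivAt_u1FlowField_circleDrift (c : ℝ) (V : GaugeConfig d L Circle) (e : Edge d L) :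
    HasFDerivAt (fun p : Edge d L → ℝ => ∑ ν ∈ Finset.univ.erase e.2,
        (((plaquetteHolonomy ((fun i : Edge d L => Circle.exp (c * p i)) * V) (e.1 - Pi.single ν 1) e.2 ν : Circle) : ℂ).im -
          ((plaquetteHolonomy ((fun i : Edge d L => Circle.exp (c * p i)) * V) e.1 e.2 ν : Circle) : ℂ).im))
      (∑ ν ∈ Finset.univ.erase e.2,
        ((c * ((plaquetteHolonomy V (e.1 - Pi.single ν 1) e.2 ν : Circle) : ℂ).re) •
          (ContinuousLinearMap.proj (R := ℝ) (φ := fun _ : Edge d L => ℝ) (e.1 - Pi.single ν 1, e.2) +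
            ContinuousLinearMap.proj (R := ℝ) (φ := fun _ : Edge d L => ℝ) ((e.1 - Pi.single ν 1).shift e.2, ν) -
            ContinuousLinearMap.proj (R := ℝ) (φ := fun _ : Edge d L => ℝ) ((e.1 - Pi.single ν 1).shift ν, e.2) -
            ContinuousLinearMap.proj (R := ℝ) (φ := fun _ : Edge d L => ℝ) (e.1 - Pi.single ν 1, ν)) -
        (c * ((plaquetteHolonomy V e.1 e.2 ν : Circle) : ℂ).re) •
          (ContinuousLinearMap.proj (R := ℝ) (φ := fun _ : Edge d L => ℝ) (e.1, e.2) +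
            ContinuousLinearMap.proj (R := ℝ) (φ := fun _ : Edge d L => ℝ) (e.1.shift e.2, ν) -
            ContinuousLinearMap.proj (R := ℝ) (φ := fun _ : Edge d L => ℝ) (e.1.shift ν, e.2) -
            ContinuousLinearMap.proj (R := ℝ) (φ := fun _ : Edge d L => ℝ) (e.1, ν)))) 0 := by
  refine HasFDerivAt.fun_sum fun ν _ => ?_
  exact (hasFDerivAt_im_plaquetteHolonomy_circleDrift c V (e.1 - Pi.single ν 1) e.2 ν).sub
    (hasFDerivAt_im_plaquetteHolonomy_circleDrift c V e.1 e.2 ν)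

/-- **The derivative at `p = 0` of `p ↦ C_e(e^(icp)·V)`**, `C_e = Σ_(ν ≠ μ) [Re P(x;μ,ν) + Re P(x−ν̂;μ,ν)]`:
the functional `Σ_ν [(−c Im P(V; x,μ,ν)) • ℓ_(x,μ,ν) + (−c Im P(V; x−ν̂,μ,ν)) • ℓ_(x−ν̂,μ,ν)]`. -/
theorem hasFDerivAt_u1Factor_circleDrift (c : ℝ) (V : GaugeConfig d L Circle) (e : Edge d L) :
    HasFDerivAt (fun p : Edge d L → ℝ => ∑ ν ∈ Finset.univ.erase e.2,
        (((plaquetteHolonomy ((fun i : Edge d L => Circle.exp (c * p i)) * V) e.1 e.2 ν : Circle) : ℂ).re +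
          ((plaquetteHolonomy ((fun i : Edge d L => Circle.exp (c * p i)) * V) (e.1 - Pi.single ν 1) e.2 ν : Circle) : ℂ).re))
      (∑ ν ∈ Finset.univ.erase e.2,
        ((-(c * ((plaquetteHolonomy V e.1 e.2 ν : Circle) : ℂ).im)) •
          (ContinuousLinearMap.proj (R := ℝ) (φ := fun _ : Edge d L => ℝ) (e.1, e.2) +
            ContinuousLinearMap.proj (R := ℝ) (φ := fun _ : Edge d L => ℝ) (e.1.shift e.2, ν) -
            ContinuousLinearMap.proj (R := ℝ) (φ := fun _ : Edge d L => ℝ) (e.1.shift ν, e.2) -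
            ContinuousLinearMap.proj (R := ℝ) (φ := fun _ : Edge d L => ℝ) (e.1, ν)) +
        (-(c * ((plaquetteHolonomy V (e.1 - Pi.single ν 1) e.2 ν : Circle) : ℂ).im)) •
          (ContinuousLinearMap.proj (R := ℝ) (φ := fun _ : Edge d L => ℝ) (e.1 - Pi.single ν 1, e.2) +
            ContinuousLinearMap.proj (R := ℝ) (φ := fun _ : Edge d L => ℝ) ((e.1 - Pi.single ν 1).shift e.2, ν) -
            ContinuousLinearMap.proj (R := ℝ) (φ := fun _ : Edge d L => ℝ) ((e.1 - Pi.single ν 1).shift ν, e.2) -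
            ContinuousLinearMap.proj (R := ℝ) (φ := fun _ : Edge d L => ℝ) (e.1 - Pi.single ν 1, ν)))) 0 := by
  refine HasFDerivAt.fun_sum fun ν _ => ?_
  exact (hasFDerivAt_re_plaquetteHolonomy_circleDrift c V e.1 e.2 ν).add
    (hasFDerivAt_re_plaquetteHolonomy_circleDrift c V (e.1 - Pi.single ν 1) e.2 ν)

end Field

/-! ## §4 Incidence numbers and the two translation counts -/

section Count

/-- **`|ℓ_(x,i,j)(δ_e')| ≤ [e'=(x,i)] + [e'=(x+î,j)] + [e'=(x+ĵ,i)] + [e'=(x,j)]`.** -/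
theorem abs_incidence_single_le [DecidableEq (Edge d L)] (x : Site d L) (i j : Fin d) (e' : Edge d L) :
    |(Pi.single e' (1 : ℝ) : Edge d L → ℝ) (x, i) + (Pi.single e' (1 : ℝ) : Edge d L → ℝ) (x.shift i, j) -
        (Pi.single e' (1 : ℝ) : Edge d L → ℝ) (x.shift j, i) - (Pi.single e' (1 : ℝ) : Edge d L → ℝ) (x, j)| ≤
      (if (x, i) = e' then 1 else 0) + (if (x.shift i, j) = e' then 1 else 0) +
        (if (x.shift j, i) = e' then 1 else 0) + (if (x, j) = e' then (1 : ℝ) else 0) := by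
  have hs : ∀ e : Edge d L, (Pi.single e' (1 : ℝ) : Edge d L → ℝ) e = if e = e' then 1 else 0 :=
    fun e => by rw [Pi.single_apply]
  have hnn : ∀ e : Edge d L, 0 ≤ (if e = e' then (1 : ℝ) else 0) := fun e => by
    split_ifs <;> norm_num
  rw [hs, hs, hs, hs]
  have h1 := hnn (x, i)
  have h2 := hnn (x.shift i, j)
  have h3 := hnn (x.shift j, i)
  have h4 := hnn (x, j)
  refine (abs_sub _ _).trans ?_
  refine (add_le_add ((abs_sub _ _).trans (add_le_add (abs_add_le _ _) le_rfl)) le_rfl).trans ?_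
  rw [abs_of_nonneg h1, abs_of_nonneg h2, abs_of_nonneg h3, abs_of_nonneg h4]

/-- **Translation count, own direction**: for every family of translations `τ μ ν`,
`Σ_((y,μ)) Σ_(ν ≠ μ) [e' = (y + τ μ ν, μ)] = d − 1`. -/
theorem sum_ite_edge_translate_fst [DecidableEq (Edge d L)] [NeZero L] (τ : Fin d → Fin d → Site d L)
    (e' : Edge d L) :
    ∑ e : Edge d L, ∑ ν ∈ Finset.univ.erase e.2, (if (e.1 + τ e.2 ν, e.2) = e' then (1 : ℝ) else 0) =
      ((d - 1 : ℕ) : ℝ) := by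
  classical
  rw [Fintype.sum_prod_type, Finset.sum_comm]
  -- now `Σ_μ Σ_y Σ_(ν ≠ μ) [...]`
  have key : ∀ μ : Fin d, ∑ y : Site d L, ∑ ν ∈ Finset.univ.erase μ,
      (if (y + τ μ ν, μ) = e' then (1 : ℝ) else 0) = if μ = e'.2 then ((d - 1 : ℕ) : ℝ) else 0 := by
    intro μ
    rw [Finset.sum_comm]
    by_cases hμ : μ = e'.2
    · rw [if_pos hμ]
      have hin : ∀ ν ∈ Finset.univ.erase μ, ∑ y : Site d L, (if (y + τ μ ν, μ) = e' then (1 : ℝ) else 0) = 1 := by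
        intro ν _
        have heq : ∀ y : Site d L, ((y + τ μ ν, μ) = e') = (y = e'.1 - τ μ ν) := by
          intro y
          rw [Prod.ext_iff]
          simp only [hμ, and_true, eq_sub_iff_add_eq]
        simp_rw [heq]
        rw [Finset.sum_ite_eq' Finset.univ (e'.1 - τ μ ν) (fun _ => (1 : ℝ))]
        simp
      rw [Finset.sum_congr rfl hin, Finset.sum_const, nsmul_eq_mul, mul_one,
        Finset.card_erase_of_mem (Finset.mem_univ _), Finset.card_univ, Fintype.card_fin]
    · rw [if_neg hμ]
      refine Finset.sum_eq_zero fun ν _ => Finset.sum_eq_zero fun y _ => ?_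
      rw [if_neg]
      intro h
      exact hμ (Prod.ext_iff.mp h).2
  simp_rw [key]
  rw [Finset.sum_ite_eq' Finset.univ e'.2 (fun _ => ((d - 1 : ℕ) : ℝ))]
  simp

/-- **Translation count, transverse direction**: `Σ_((y,μ)) Σ_(ν ≠ μ) [e' = (y + τ μ ν, ν)] = d − 1`. -/
theorem sum_ite_edge_translate_snd [DecidableEq (Edge d L)] [NeZero L] (τ : Fin d → Fin d → Site d L)
    (e' : Edge d L) :
    ∑ e : Edge d L, ∑ ν ∈ Finset.univ.erase e.2, (if (e.1 + τ e.2 ν, ν) = e' then (1 : ℝ) else 0) =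
      ((d - 1 : ℕ) : ℝ) := by
  classical
  rw [Fintype.sum_prod_type, Finset.sum_comm]
  have key : ∀ μ : Fin d, ∑ y : Site d L, ∑ ν ∈ Finset.univ.erase μ,
      (if (y + τ μ ν, ν) = e' then (1 : ℝ) else 0) = if μ ≠ e'.2 then 1 else 0 := by
    intro μ
    rw [Finset.sum_comm]
    have hin : ∀ ν ∈ Finset.univ.erase μ, ∑ y : Site d L, (if (y + τ μ ν, ν) = e' then (1 : ℝ) else 0) =
        if ν = e'.2 then 1 else 0 := by
      intro ν _
      by_cases hν : ν = e'.2
      · rw [if_pos hν]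
        have heq : ∀ y : Site d L, ((y + τ μ ν, ν) = e') = (y = e'.1 - τ μ ν) := by
          intro y
          rw [Prod.ext_iff]
          simp only [hν, and_true, eq_sub_iff_add_eq]
        simp_rw [heq]
        rw [Finset.sum_ite_eq' Finset.univ (e'.1 - τ μ ν) (fun _ => (1 : ℝ))]
        simp
      · rw [if_neg hν]
        refine Finset.sum_eq_zero fun y _ => ?_
        rw [if_neg]
        intro h
        exact hν (Prod.ext_iff.mp h).2
    rw [Finset.sum_congr rfl hin, Finset.sum_ite_eq' (Finset.univ.erase μ) e'.2 (fun _ => (1 : ℝ))]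
    by_cases hμ : μ ≠ e'.2
    · rw [if_pos hμ, if_pos (Finset.mem_erase.mpr ⟨Ne.symm hμ, Finset.mem_univ _⟩)]
    · rw [if_neg hμ, if_neg]
      rw [not_ne_iff.mp hμ]
      exact Finset.notMem_erase _ _
  simp_rw [key]
  rw [Finset.sum_ite, Finset.sum_const_zero, add_zero, Finset.sum_const, nsmul_eq_mul, mul_one]
  have : (Finset.univ.filter fun μ : Fin d => μ ≠ e'.2) = Finset.univ.erase e'.2 := by
    ext μ
    simp [Finset.mem_erase]
  rw [this, Finset.card_erase_of_mem (Finset.mem_univ _), Finset.card_univ, Fintype.card_fin]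

end Count

end Summit.Ventures.LatticeQCDFlow.Exactness
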